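import Mathlib
import Summits.PneNP.PneNP.Theorems.OverlapGapAlgebraSolvableImpliesStableSectionMonotoneRepairWeightStep

/-!
# PneNP / OverlapGapAlgebra — crux `SolvableImpliesStableSection` (stmt-PneNP-2463):
# the MONOTONE REPAIR block (8/·) — tree codes: geometric decay of the weights

Support for crux `stmt-PneNP-2463` (`Summit.PneNP.PneNP.Theses.OverlapGapAlgebra.SolvableImpliesStableSection`):
the f-free block "bounded-round monotone repair gives stable sections up to `α ≤ 2^k/(4k)`".
Write `A_d(s)` for the total weight of the locally valid codes of `TS d` with a childless root slot
and root round `s` (up to the factor `#Inst`, the expected number of injective witness trees of clauses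
flipping at round `s`).  From the one-step bounds of `…MonotoneRepairWeightStep`:

* `sissR_exp_bound` — `(1 + 1/(2k))^{k-1} ≤ 17/10`; `sissR_num_core` — the scalar inequality of
  the induction step;
* `sissR_weight_decay` — under `4k·m ≤ 2^k·n` (density `≤ 2^k/(4k)`):
  `A_d(s) ≤ m·2^{-k}·2^{-s}` for all `d, s` (the cascade of newly violated clauses dies out
  geometrically: ratio `k·(m/n)·2^{-k}·2·(17/10) ≤ 0.85`, against the factor `2` per round);
* `sissR_weight_root` — the locally valid codes of `TS (d+1)` with root round `Λ ≥ 1` (witness trees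
  of a clause violated after `Λ` rounds: recent child or full root) have total weight
  `≤ m·2^{-k}·(2^{-Λ} + (2m/(2^k n))^k)`.
No definitions (all objects are hypotheses); axioms `propext`, `Classical.choice`, `Quot.sound`.
-/

set_option linter.dupNamespace false -- `Summit.PneNP.PneNP.…`: summit = sub-problem (D-0017)

namespace Summit.PneNP.PneNP.Theorems

open Finset
open scoped Classical

section WeightBound

variable {m k n : ℕ}

/-- `(1 + 1/(2k))^{k-1} ≤ 17/10` for `k ≥ 1` (through `e^{1/2} < 1.7`). -/
theorem sissR_exp_bound (k : ℕ) (hk : 1 ≤ k) : (1 + 1 / (2 * (k : ℝ))) ^ (k - 1) ≤ 17 / 10 := by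
  have hk0 : (0 : ℝ) < k := by exact_mod_cast hk
  have hbase : (1 : ℝ) ≤ 1 + 1 / (2 * (k : ℝ)) := by
    have : (0 : ℝ) ≤ 1 / (2 * (k : ℝ)) := by positivity
    linarith
  have h1 : (1 + 1 / (2 * (k : ℝ))) ^ (k - 1) ≤ (1 + 1 / (2 * (k : ℝ))) ^ k :=
    pow_le_pow_right₀ hbase (Nat.sub_le k 1)
  have h2 : (1 + 1 / (2 * (k : ℝ))) ^ k ≤ Real.exp (1 / 2) := by
    have hle : 1 + 1 / (2 * (k : ℝ)) ≤ Real.exp (1 / (2 * (k : ℝ))) := by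
      have := Real.add_one_le_exp (1 / (2 * (k : ℝ)))
      linarith
    calc (1 + 1 / (2 * (k : ℝ))) ^ k ≤ (Real.exp (1 / (2 * (k : ℝ)))) ^ k :=
          pow_le_pow_left₀ (by positivity) hle k
      _ = Real.exp (k * (1 / (2 * (k : ℝ)))) := (Real.exp_nat_mul _ k).symm
      _ = Real.exp (1 / 2) := by congr 1; field_simp
  have h3 : Real.exp (1 / 2) ≤ 17 / 10 := by
    by_contra hcon
    push Not at hcon
    have hsq : (17 / 10 : ℝ) ^ 2 < Real.exp (1 / 2) ^ 2 := pow_lt_pow_left₀ hcon (by norm_num) (by norm_num)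
    have hexp : Real.exp (1 / 2) ^ 2 = Real.exp 1 := by
      rw [← Real.exp_nat_mul]; norm_num
    rw [hexp] at hsq
    have := Real.exp_one_lt_d9
    norm_num at hsq
    linarith
  exact h1.trans (h2.trans h3)

/-- `2^{-(s-1)} = 2 · 2^{-s}` for `s ≥ 1`. -/
theorem sissR_half_pow_pred (s : ℕ) (hs : 1 ≤ s) : (1 / 2 : ℝ) ^ (s - 1) = 2 * (1 / 2 : ℝ) ^ s := by
  obtain ⟨t, rfl⟩ := Nat.exists_eq_add_of_le hs
  rw [Nat.add_sub_cancel_left, pow_add, pow_one, ← mul_assoc]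
  norm_num

/-- **The scalar induction step.** With `D = m 2^{-k}/n ≤ 1/(4k)`, a recent weight
`a ≤ D·2^{-(s-1)}` and a lower weight `u ≤ 1/(2k)`:
`M·k·2^{-k}·a·(1+u)^{k-1} ≤ M·2^{-k}·2^{-s}`. -/
theorem sissR_num_core (k s : ℕ) (hk : 1 ≤ k) (hs : 1 ≤ s) (M D a u : ℝ) (hM : 0 ≤ M) (hD : 0 ≤ D)
    (hkD : (k : ℝ) * D ≤ 1 / 4) (ha : a ≤ D * (1 / 2 : ℝ) ^ (s - 1))
    (hu0 : 0 ≤ u) (hu : u ≤ 1 / (2 * (k : ℝ))) :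
    M * k * (1 / 2 : ℝ) ^ k * a * (1 + u) ^ (k - 1) ≤ M * (1 / 2 : ℝ) ^ k * (1 / 2 : ℝ) ^ s := by
  have hk0 : (0 : ℝ) < k := by exact_mod_cast hk
  have hpow : (1 + u) ^ (k - 1) ≤ 17 / 10 :=
    (pow_le_pow_left₀ (by linarith) (by linarith) (k - 1)).trans (sissR_exp_bound k hk)
  have hpow0 : 0 ≤ (1 + u) ^ (k - 1) := pow_nonneg (by linarith) _
  rw [sissR_half_pow_pred s hs] at ha
  have hP : 0 ≤ M * (1 / 2 : ℝ) ^ k * (1 / 2 : ℝ) ^ s := by positivity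
  calc M * k * (1 / 2 : ℝ) ^ k * a * (1 + u) ^ (k - 1)
      ≤ M * k * (1 / 2 : ℝ) ^ k * (D * (2 * (1 / 2 : ℝ) ^ s)) * (17 / 10) := by
        apply mul_le_mul (mul_le_mul_of_nonneg_left ha (by positivity)) hpow hpow0 (by positivity)
    _ = M * (1 / 2 : ℝ) ^ k * (1 / 2 : ℝ) ^ s * ((k * D) * (17 / 5)) := by ring
    _ ≤ M * (1 / 2 : ℝ) ^ k * (1 / 2 : ℝ) ^ s * ((1 / 4 : ℝ) * (17 / 5)) :=
        mul_le_mul_of_nonneg_left (mul_le_mul_of_nonneg_right hkD (by norm_num)) hP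
    _ ≤ M * (1 / 2 : ℝ) ^ k * (1 / 2 : ℝ) ^ s := by nlinarith

/-- **Geometric decay of the weights.** Under `4k·m ≤ 2^k·n`, for every depth `d` and round `s`, the
locally valid codes of `TS d` with a childless root slot and root round `s` have total weight at most
`m·2^{-k}·2^{-s}`. -/
theorem sissR_weight_decay (asm : Fin m → ℕ → (Fin k → Option (Finset (List (Fin k) × (Fin m × ℕ)))) → Finset (List (Fin k) × (Fin m × ℕ)))
    (hasm : ∀ (c : Fin m) (r : ℕ) (ch : Fin k → Option (Finset (List (Fin k) × (Fin m × ℕ))))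
      (e : (List (Fin k) × (Fin m × ℕ))), e ∈ asm c r ch ↔ (e = ([], (c, r)) ∨
      ∃ (j : Fin k) (S : Finset (List (Fin k) × (Fin m × ℕ))), ch j = some S ∧
        ∃ b : List (Fin k), (b, e.2) ∈ S ∧ e.1 = b ++ [j]))
    (TS : ℕ → Finset (Finset (List (Fin k) × (Fin m × ℕ)))) (L : ℕ)
    (hTS0 : ∀ T : Finset (List (Fin k) × (Fin m × ℕ)), T ∈ TS 0 ↔
      ∃ (c : Fin m) (r : ℕ), r ≤ L ∧ T = asm c r (fun _ => none))
    (hTSs : ∀ (d : ℕ) (T : Finset (List (Fin k) × (Fin m × ℕ))), T ∈ TS (d + 1) ↔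
      ∃ (c : Fin m) (r : ℕ), r ≤ L ∧ ∃ ch : Fin k → Option (Finset (List (Fin k) × (Fin m × ℕ))),
        (∀ (j : Fin k) (S : Finset (List (Fin k) × (Fin m × ℕ))), ch j = some S → S ∈ TS d) ∧ T = asm c r ch)
    (hk : 1 ≤ k) (hn : 1 ≤ n) (hα : (m : ℝ) * (4 * k) ≤ (n : ℝ) * 2 ^ k) :
    ∀ (d s : ℕ), ∑ S ∈ (TS d).filter (fun S => ((∀ e ∈ S, ∀ (j : Fin k) (y : Fin m) (s : ℕ), (j :: e.1, (y, s)) ∈ S →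
        s < e.2.2 ∧ ∃ j' : Fin k, ∀ lab : Fin m × ℕ, (j' :: j :: e.1, lab) ∉ S) ∧
      (∀ e ∈ S, 1 ≤ e.2.2 → (∃ (j : Fin k) (y : Fin m), (j :: e.1, (y, e.2.2 - 1)) ∈ S) ∨
        (e.1 = [] ∧ ∀ j : Fin k, ∃ lab : Fin m × ℕ, ([j], lab) ∈ S))) ∧ (∃ j : Fin k, ∀ lab : Fin m × ℕ, ([j], lab) ∉ S) ∧
        ∃ y : Fin m, (([] : List (Fin k)), (y, s)) ∈ S), (∏ e ∈ S, ((1 / 2 : ℝ) ^ k * (if e.1 = [] then (1 : ℝ) else 1 / (n : ℝ))))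
      ≤ (m : ℝ) * (1 / 2 : ℝ) ^ k * (1 / 2 : ℝ) ^ s := by
  have hk0 : (0 : ℝ) < k := by exact_mod_cast hk
  have hn0 : (0 : ℝ) < n := by exact_mod_cast hn
  have hm0 : (0 : ℝ) ≤ m := Nat.cast_nonneg _
  -- the key density consequence: `D = m 2^{-k} / n ≤ 1/(4k)`
  have hdens : (m : ℝ) * (1 / 2 : ℝ) ^ k / n ≤ 1 / (4 * k) := by
    rw [div_le_div_iff₀ hn0 (by positivity), one_div_pow, ← div_eq_mul_one_div, div_mul_eq_mul_div,
      div_le_iff₀ (by positivity)]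
    linarith
  have hkD : (k : ℝ) * ((m : ℝ) * (1 / 2 : ℝ) ^ k / n) ≤ 1 / 4 := by
    calc (k : ℝ) * ((m : ℝ) * (1 / 2 : ℝ) ^ k / n) ≤ k * (1 / (4 * k)) :=
          mul_le_mul_of_nonneg_left hdens hk0.le
      _ = 1 / 4 := by field_simp
  -- round `0` at any positive depth
  have hzero : ∀ d : ℕ, ∑ S ∈ (TS (d + 1)).filter (fun S => ((∀ e ∈ S, ∀ (j : Fin k) (y : Fin m) (s : ℕ), (j :: e.1, (y, s)) ∈ S →
        s < e.2.2 ∧ ∃ j' : Fin k, ∀ lab : Fin m × ℕ, (j' :: j :: e.1, lab) ∉ S) ∧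
      (∀ e ∈ S, 1 ≤ e.2.2 → (∃ (j : Fin k) (y : Fin m), (j :: e.1, (y, e.2.2 - 1)) ∈ S) ∨
        (e.1 = [] ∧ ∀ j : Fin k, ∃ lab : Fin m × ℕ, ([j], lab) ∈ S))) ∧ (∃ j : Fin k, ∀ lab : Fin m × ℕ, ([j], lab) ∉ S) ∧
      ∃ y : Fin m, (([] : List (Fin k)), (y, 0)) ∈ S), (∏ e ∈ S, ((1 / 2 : ℝ) ^ k * (if e.1 = [] then (1 : ℝ) else 1 / (n : ℝ)))) ≤ (m : ℝ) * (1 / 2 : ℝ) ^ k := by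
    intro d
    refine le_trans (Finset.sum_le_sum_of_subset_of_nonneg ?_ fun S _ _ => sissR_wt_nonneg S)
      (sissR_weight_zero asm hasm TS L hTS0 hTSs d)
    intro S hS
    rw [Finset.mem_filter] at hS ⊢
    exact ⟨hS.1, hS.2.1, hS.2.2.2⟩
  intro d
  induction d with
  | zero =>
    intro s
    rcases Nat.eq_zero_or_pos s with hs0 | hs
    · rw [hs0, pow_zero, mul_one]
      refine le_trans (Finset.sum_le_sum_of_subset_of_nonneg ?_ fun S _ _ => sissR_wt_nonneg S) (hzero 0)
      intro S hS
      rw [Finset.mem_filter] at hS ⊢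
      exact ⟨sissR_TS_mono asm TS L hTS0 hTSs 0 S hS.1, hS.2⟩
    · have hempty := sissR_weight_base_empty asm hasm TS L hTS0 hk s hs
      have hsub : (TS 0).filter (fun S => ((∀ e ∈ S, ∀ (j : Fin k) (y : Fin m) (s : ℕ), (j :: e.1, (y, s)) ∈ S →
        s < e.2.2 ∧ ∃ j' : Fin k, ∀ lab : Fin m × ℕ, (j' :: j :: e.1, lab) ∉ S) ∧
      (∀ e ∈ S, 1 ≤ e.2.2 → (∃ (j : Fin k) (y : Fin m), (j :: e.1, (y, e.2.2 - 1)) ∈ S) ∨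
        (e.1 = [] ∧ ∀ j : Fin k, ∃ lab : Fin m × ℕ, ([j], lab) ∈ S))) ∧ (∃ j : Fin k, ∀ lab : Fin m × ℕ, ([j], lab) ∉ S) ∧
          ∃ y : Fin m, (([] : List (Fin k)), (y, s)) ∈ S) = ∅ := by
        rw [← Finset.subset_empty, ← hempty]
        intro S hS
        rw [Finset.mem_filter] at hS ⊢
        exact ⟨hS.1, hS.2.1, hS.2.2.2⟩
      rw [hsub, Finset.sum_empty]
      positivity
  | succ d ih =>
    intro s
    rcases Nat.eq_zero_or_pos s with hs0 | hs
    · rw [hs0, pow_zero, mul_one]; exact hzero d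
    -- recency at the root (fullness contradicts the childless root slot)
    have hsub : (TS (d + 1)).filter (fun S => ((∀ e ∈ S, ∀ (j : Fin k) (y : Fin m) (s : ℕ), (j :: e.1, (y, s)) ∈ S →
        s < e.2.2 ∧ ∃ j' : Fin k, ∀ lab : Fin m × ℕ, (j' :: j :: e.1, lab) ∉ S) ∧
      (∀ e ∈ S, 1 ≤ e.2.2 → (∃ (j : Fin k) (y : Fin m), (j :: e.1, (y, e.2.2 - 1)) ∈ S) ∨
        (e.1 = [] ∧ ∀ j : Fin k, ∃ lab : Fin m × ℕ, ([j], lab) ∈ S))) ∧ (∃ j : Fin k, ∀ lab : Fin m × ℕ, ([j], lab) ∉ S) ∧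
        ∃ y : Fin m, (([] : List (Fin k)), (y, s)) ∈ S) ⊆
        (TS (d + 1)).filter (fun T => ((∀ e ∈ T, ∀ (j : Fin k) (y : Fin m) (s : ℕ), (j :: e.1, (y, s)) ∈ T →
        s < e.2.2 ∧ ∃ j' : Fin k, ∀ lab : Fin m × ℕ, (j' :: j :: e.1, lab) ∉ T) ∧
      (∀ e ∈ T, 1 ≤ e.2.2 → (∃ (j : Fin k) (y : Fin m), (j :: e.1, (y, e.2.2 - 1)) ∈ T) ∨
        (e.1 = [] ∧ ∀ j : Fin k, ∃ lab : Fin m × ℕ, ([j], lab) ∈ T))) ∧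
          (∃ y : Fin m, (([] : List (Fin k)), (y, s)) ∈ T) ∧
          ∃ (j : Fin k) (y : Fin m), ([j], (y, s - 1)) ∈ T) := by
      intro S hS
      rw [Finset.mem_filter] at hS ⊢
      obtain ⟨hTS, hloc, ⟨j₀, hj₀⟩, y, hy⟩ := hS
      refine ⟨hTS, hloc, ⟨y, hy⟩, ?_⟩
      rcases hloc.2 _ hy hs with ⟨j, y', hy'⟩ | ⟨_, hall⟩
      · exact ⟨j, y', hy'⟩
      · obtain ⟨lab, hlab⟩ := hall j₀
        exact absurd hlab (hj₀ lab)
    refine le_trans (Finset.sum_le_sum_of_subset_of_nonneg hsub fun S _ _ => sissR_wt_nonneg S) ?_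
    refine (sissR_weight_recent asm hasm TS L hTS0 hTSs d s).trans ?_
    -- name the two sums of the previous depth
    set Asum : ℝ := ∑ S ∈ (TS d).filter (fun S => ((∀ e ∈ S, ∀ (j : Fin k) (y : Fin m) (s : ℕ), (j :: e.1, (y, s)) ∈ S →
        s < e.2.2 ∧ ∃ j' : Fin k, ∀ lab : Fin m × ℕ, (j' :: j :: e.1, lab) ∉ S) ∧
      (∀ e ∈ S, 1 ≤ e.2.2 → (∃ (j : Fin k) (y : Fin m), (j :: e.1, (y, e.2.2 - 1)) ∈ S) ∨
        (e.1 = [] ∧ ∀ j : Fin k, ∃ lab : Fin m × ℕ, ([j], lab) ∈ S))) ∧ (∃ j : Fin k, ∀ lab : Fin m × ℕ, ([j], lab) ∉ S) ∧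
        ∃ y : Fin m, (([] : List (Fin k)), (y, s - 1)) ∈ S), (∏ e ∈ S, ((1 / 2 : ℝ) ^ k * (if e.1 = [] then (1 : ℝ) else 1 / (n : ℝ)))) with hAsum
    set Usum : ℝ := ∑ S ∈ (TS d).filter (fun S => ((∀ e ∈ S, ∀ (j : Fin k) (y : Fin m) (s : ℕ), (j :: e.1, (y, s)) ∈ S →
        s < e.2.2 ∧ ∃ j' : Fin k, ∀ lab : Fin m × ℕ, (j' :: j :: e.1, lab) ∉ S) ∧
      (∀ e ∈ S, 1 ≤ e.2.2 → (∃ (j : Fin k) (y : Fin m), (j :: e.1, (y, e.2.2 - 1)) ∈ S) ∨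
        (e.1 = [] ∧ ∀ j : Fin k, ∃ lab : Fin m × ℕ, ([j], lab) ∈ S))) ∧ (∃ j : Fin k, ∀ lab : Fin m × ℕ, ([j], lab) ∉ S) ∧
        ∃ (y : Fin m) (s' : ℕ), (([] : List (Fin k)), (y, s')) ∈ S ∧ s' < s), (∏ e ∈ S, ((1 / 2 : ℝ) ^ k * (if e.1 = [] then (1 : ℝ) else 1 / (n : ℝ)))) with hUsum
    have hA : Asum ≤ (m : ℝ) * (1 / 2 : ℝ) ^ k * (1 / 2 : ℝ) ^ (s - 1) := ih (s - 1)
    have hU0 : 0 ≤ Usum := Finset.sum_nonneg fun S _ => sissR_wt_nonneg S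
    -- cover `Usum` by the round classes `s' < s`, then the geometric series
    have hUle : Usum ≤ (m : ℝ) * (1 / 2 : ℝ) ^ k * 2 := by
      have hcov := sissR_sum_cover_le ((TS d).filter (fun S => ((∀ e ∈ S, ∀ (j : Fin k) (y : Fin m) (s : ℕ), (j :: e.1, (y, s)) ∈ S →
        s < e.2.2 ∧ ∃ j' : Fin k, ∀ lab : Fin m × ℕ, (j' :: j :: e.1, lab) ∉ S) ∧
      (∀ e ∈ S, 1 ≤ e.2.2 → (∃ (j : Fin k) (y : Fin m), (j :: e.1, (y, e.2.2 - 1)) ∈ S) ∨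
        (e.1 = [] ∧ ∀ j : Fin k, ∃ lab : Fin m × ℕ, ([j], lab) ∈ S))) ∧ (∃ j : Fin k, ∀ lab : Fin m × ℕ, ([j], lab) ∉ S) ∧
          ∃ (y : Fin m) (s' : ℕ), (([] : List (Fin k)), (y, s')) ∈ S ∧ s' < s)) (Finset.range s)
        (fun s' => (TS d).filter (fun S => ((∀ e ∈ S, ∀ (j : Fin k) (y : Fin m) (s : ℕ), (j :: e.1, (y, s)) ∈ S →
        s < e.2.2 ∧ ∃ j' : Fin k, ∀ lab : Fin m × ℕ, (j' :: j :: e.1, lab) ∉ S) ∧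
      (∀ e ∈ S, 1 ≤ e.2.2 → (∃ (j : Fin k) (y : Fin m), (j :: e.1, (y, e.2.2 - 1)) ∈ S) ∨
        (e.1 = [] ∧ ∀ j : Fin k, ∃ lab : Fin m × ℕ, ([j], lab) ∈ S))) ∧ (∃ j : Fin k, ∀ lab : Fin m × ℕ, ([j], lab) ∉ S) ∧
          ∃ y : Fin m, (([] : List (Fin k)), (y, s')) ∈ S))
        (fun S => ∏ e ∈ S, ((1 / 2 : ℝ) ^ k * (if e.1 = [] then (1 : ℝ) else 1 / (n : ℝ)))) sissR_wt_nonneg (by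
          intro S hS
          rw [Finset.mem_filter] at hS
          obtain ⟨hTS, hl, hno, y, s', hy, hs'⟩ := hS
          exact ⟨s', Finset.mem_range.2 hs', by rw [Finset.mem_filter]; exact ⟨hTS, hl, hno, y, hy⟩⟩)
      have hgeo : ∑ s' ∈ Finset.range s, (m : ℝ) * (1 / 2 : ℝ) ^ k * (1 / 2 : ℝ) ^ s'
          ≤ (m : ℝ) * (1 / 2 : ℝ) ^ k * 2 := by
        rw [← Finset.mul_sum]
        refine mul_le_mul_of_nonneg_left ?_ (by positivity)
        have := geom_sum_Ico_le_of_lt_one (show (0 : ℝ) ≤ 1 / 2 by norm_num)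
          (show (1 / 2 : ℝ) < 1 by norm_num) (m := 0) (n := s)
        rw [Finset.range_eq_Ico]
        refine this.trans ?_
        norm_num
      exact (hcov.trans (Finset.sum_le_sum fun s' _ => ih s')).trans hgeo
    -- the scalar step
    have ha : Asum / n ≤ (m : ℝ) * (1 / 2 : ℝ) ^ k / n * (1 / 2 : ℝ) ^ (s - 1) := by
      rw [div_mul_eq_mul_div]
      exact div_le_div_of_nonneg_right hA hn0.le
    have hu : Usum / n ≤ 1 / (2 * (k : ℝ)) := by
      calc Usum / n ≤ (m : ℝ) * (1 / 2 : ℝ) ^ k * 2 / n := div_le_div_of_nonneg_right hUle hn0.le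
        _ = 2 * ((m : ℝ) * (1 / 2 : ℝ) ^ k / n) := by ring
        _ ≤ 2 * (1 / (4 * k)) := by linarith [hdens]
        _ = 1 / (2 * k) := by field_simp; ring
    have := sissR_num_core k s hk hs (m : ℝ) ((m : ℝ) * (1 / 2 : ℝ) ^ k / n) (Asum / n) (Usum / n)
      hm0 (by positivity) hkD ha (div_nonneg hU0 hn0.le) hu
    linarith [this]

/-- **Weight of the witness trees of a clause violated after `Λ` rounds.** Under `4k·m ≤ 2^k·n`, the
locally valid codes of `TS (d+1)` with root round `Λ ≥ 1` have total weight at most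
`m·2^{-k}·(2^{-Λ} + (2m/(2^k n))^k)` (recent child: the geometric term; full root: the dead term). -/
theorem sissR_weight_root (asm : Fin m → ℕ → (Fin k → Option (Finset (List (Fin k) × (Fin m × ℕ)))) → Finset (List (Fin k) × (Fin m × ℕ)))
    (hasm : ∀ (c : Fin m) (r : ℕ) (ch : Fin k → Option (Finset (List (Fin k) × (Fin m × ℕ))))
      (e : (List (Fin k) × (Fin m × ℕ))), e ∈ asm c r ch ↔ (e = ([], (c, r)) ∨
      ∃ (j : Fin k) (S : Finset (List (Fin k) × (Fin m × ℕ))), ch j = some S ∧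
        ∃ b : List (Fin k), (b, e.2) ∈ S ∧ e.1 = b ++ [j]))
    (TS : ℕ → Finset (Finset (List (Fin k) × (Fin m × ℕ)))) (L : ℕ)
    (hTS0 : ∀ T : Finset (List (Fin k) × (Fin m × ℕ)), T ∈ TS 0 ↔
      ∃ (c : Fin m) (r : ℕ), r ≤ L ∧ T = asm c r (fun _ => none))
    (hTSs : ∀ (d : ℕ) (T : Finset (List (Fin k) × (Fin m × ℕ))), T ∈ TS (d + 1) ↔
      ∃ (c : Fin m) (r : ℕ), r ≤ L ∧ ∃ ch : Fin k → Option (Finset (List (Fin k) × (Fin m × ℕ))),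
        (∀ (j : Fin k) (S : Finset (List (Fin k) × (Fin m × ℕ))), ch j = some S → S ∈ TS d) ∧ T = asm c r ch)
    (hk : 1 ≤ k) (hn : 1 ≤ n) (hα : (m : ℝ) * (4 * k) ≤ (n : ℝ) * 2 ^ k)
    (d Λ : ℕ) (hΛ : 1 ≤ Λ) :
    ∑ T ∈ (TS (d + 1)).filter (fun T => ((∀ e ∈ T, ∀ (j : Fin k) (y : Fin m) (s : ℕ), (j :: e.1, (y, s)) ∈ T →
        s < e.2.2 ∧ ∃ j' : Fin k, ∀ lab : Fin m × ℕ, (j' :: j :: e.1, lab) ∉ T) ∧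
      (∀ e ∈ T, 1 ≤ e.2.2 → (∃ (j : Fin k) (y : Fin m), (j :: e.1, (y, e.2.2 - 1)) ∈ T) ∨
        (e.1 = [] ∧ ∀ j : Fin k, ∃ lab : Fin m × ℕ, ([j], lab) ∈ T))) ∧
        ∃ y : Fin m, (([] : List (Fin k)), (y, Λ)) ∈ T), (∏ e ∈ T, ((1 / 2 : ℝ) ^ k * (if e.1 = [] then (1 : ℝ) else 1 / (n : ℝ))))
      ≤ (m : ℝ) * (1 / 2 : ℝ) ^ k *
        ((1 / 2 : ℝ) ^ Λ + (2 * ((m : ℝ) * (1 / 2 : ℝ) ^ k / n)) ^ k) := by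
  have hk0 : (0 : ℝ) < k := by exact_mod_cast hk
  have hn0 : (0 : ℝ) < n := by exact_mod_cast hn
  have hm0 : (0 : ℝ) ≤ m := Nat.cast_nonneg _
  have hdens : (m : ℝ) * (1 / 2 : ℝ) ^ k / n ≤ 1 / (4 * k) := by
    rw [div_le_div_iff₀ hn0 (by positivity), one_div_pow, ← div_eq_mul_one_div, div_mul_eq_mul_div,
      div_le_iff₀ (by positivity)]
    linarith
  have hkD : (k : ℝ) * ((m : ℝ) * (1 / 2 : ℝ) ^ k / n) ≤ 1 / 4 := by
    calc (k : ℝ) * ((m : ℝ) * (1 / 2 : ℝ) ^ k / n) ≤ k * (1 / (4 * k)) :=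
          mul_le_mul_of_nonneg_left hdens hk0.le
      _ = 1 / 4 := by field_simp
  have hdecay := sissR_weight_decay asm hasm TS L hTS0 hTSs hk hn hα
  -- split by recency or fullness at the root
  have hcov := sissR_sum_cover_le ((TS (d + 1)).filter (fun T => ((∀ e ∈ T, ∀ (j : Fin k) (y : Fin m) (s : ℕ), (j :: e.1, (y, s)) ∈ T →
        s < e.2.2 ∧ ∃ j' : Fin k, ∀ lab : Fin m × ℕ, (j' :: j :: e.1, lab) ∉ T) ∧
      (∀ e ∈ T, 1 ≤ e.2.2 → (∃ (j : Fin k) (y : Fin m), (j :: e.1, (y, e.2.2 - 1)) ∈ T) ∨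
        (e.1 = [] ∧ ∀ j : Fin k, ∃ lab : Fin m × ℕ, ([j], lab) ∈ T))) ∧
      ∃ y : Fin m, (([] : List (Fin k)), (y, Λ)) ∈ T)) (univ : Finset Bool)
    (fun b => if b = true then (TS (d + 1)).filter (fun T => ((∀ e ∈ T, ∀ (j : Fin k) (y : Fin m) (s : ℕ), (j :: e.1, (y, s)) ∈ T →
        s < e.2.2 ∧ ∃ j' : Fin k, ∀ lab : Fin m × ℕ, (j' :: j :: e.1, lab) ∉ T) ∧
      (∀ e ∈ T, 1 ≤ e.2.2 → (∃ (j : Fin k) (y : Fin m), (j :: e.1, (y, e.2.2 - 1)) ∈ T) ∨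
        (e.1 = [] ∧ ∀ j : Fin k, ∃ lab : Fin m × ℕ, ([j], lab) ∈ T))) ∧
          (∃ y : Fin m, (([] : List (Fin k)), (y, Λ)) ∈ T) ∧
          ∃ (j : Fin k) (y : Fin m), ([j], (y, Λ - 1)) ∈ T)
      else (TS (d + 1)).filter (fun T => ((∀ e ∈ T, ∀ (j : Fin k) (y : Fin m) (s : ℕ), (j :: e.1, (y, s)) ∈ T →
        s < e.2.2 ∧ ∃ j' : Fin k, ∀ lab : Fin m × ℕ, (j' :: j :: e.1, lab) ∉ T) ∧
      (∀ e ∈ T, 1 ≤ e.2.2 → (∃ (j : Fin k) (y : Fin m), (j :: e.1, (y, e.2.2 - 1)) ∈ T) ∨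
        (e.1 = [] ∧ ∀ j : Fin k, ∃ lab : Fin m × ℕ, ([j], lab) ∈ T))) ∧
          (∃ y : Fin m, (([] : List (Fin k)), (y, Λ)) ∈ T) ∧
          ∀ j : Fin k, ∃ lab : Fin m × ℕ, ([j], lab) ∈ T))
    (fun T => ∏ e ∈ T, ((1 / 2 : ℝ) ^ k * (if e.1 = [] then (1 : ℝ) else 1 / (n : ℝ)))) sissR_wt_nonneg (by
      intro T hT
      rw [Finset.mem_filter] at hT
      obtain ⟨hTS, hloc, y, hy⟩ := hT
      rcases hloc.2 _ hy hΛ with ⟨j, y', hy'⟩ | ⟨_, hall⟩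
      · refine ⟨true, mem_univ _, ?_⟩
        rw [if_pos rfl, Finset.mem_filter]
        exact ⟨hTS, hloc, ⟨y, hy⟩, j, y', hy'⟩
      · refine ⟨false, mem_univ _, ?_⟩
        rw [if_neg Bool.false_ne_true, Finset.mem_filter]
        exact ⟨hTS, hloc, ⟨y, hy⟩, hall⟩)
  refine hcov.trans ?_
  rw [Fintype.sum_bool, if_pos rfl, if_neg Bool.false_ne_true]
  -- name the sums
  set Rsum : ℝ := ∑ T ∈ (TS (d + 1)).filter (fun T => ((∀ e ∈ T, ∀ (j : Fin k) (y : Fin m) (s : ℕ), (j :: e.1, (y, s)) ∈ T →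
        s < e.2.2 ∧ ∃ j' : Fin k, ∀ lab : Fin m × ℕ, (j' :: j :: e.1, lab) ∉ T) ∧
      (∀ e ∈ T, 1 ≤ e.2.2 → (∃ (j : Fin k) (y : Fin m), (j :: e.1, (y, e.2.2 - 1)) ∈ T) ∨
        (e.1 = [] ∧ ∀ j : Fin k, ∃ lab : Fin m × ℕ, ([j], lab) ∈ T))) ∧
        (∃ y : Fin m, (([] : List (Fin k)), (y, Λ)) ∈ T) ∧
        ∃ (j : Fin k) (y : Fin m), ([j], (y, Λ - 1)) ∈ T), (∏ e ∈ T, ((1 / 2 : ℝ) ^ k * (if e.1 = [] then (1 : ℝ) else 1 / (n : ℝ)))) with hRsum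
  set Fsum : ℝ := ∑ T ∈ (TS (d + 1)).filter (fun T => ((∀ e ∈ T, ∀ (j : Fin k) (y : Fin m) (s : ℕ), (j :: e.1, (y, s)) ∈ T →
        s < e.2.2 ∧ ∃ j' : Fin k, ∀ lab : Fin m × ℕ, (j' :: j :: e.1, lab) ∉ T) ∧
      (∀ e ∈ T, 1 ≤ e.2.2 → (∃ (j : Fin k) (y : Fin m), (j :: e.1, (y, e.2.2 - 1)) ∈ T) ∨
        (e.1 = [] ∧ ∀ j : Fin k, ∃ lab : Fin m × ℕ, ([j], lab) ∈ T))) ∧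
        (∃ y : Fin m, (([] : List (Fin k)), (y, Λ)) ∈ T) ∧
        ∀ j : Fin k, ∃ lab : Fin m × ℕ, ([j], lab) ∈ T), (∏ e ∈ T, ((1 / 2 : ℝ) ^ k * (if e.1 = [] then (1 : ℝ) else 1 / (n : ℝ)))) with hFsum
  set Asum : ℝ := ∑ S ∈ (TS d).filter (fun S => ((∀ e ∈ S, ∀ (j : Fin k) (y : Fin m) (s : ℕ), (j :: e.1, (y, s)) ∈ S →
        s < e.2.2 ∧ ∃ j' : Fin k, ∀ lab : Fin m × ℕ, (j' :: j :: e.1, lab) ∉ S) ∧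
      (∀ e ∈ S, 1 ≤ e.2.2 → (∃ (j : Fin k) (y : Fin m), (j :: e.1, (y, e.2.2 - 1)) ∈ S) ∨
        (e.1 = [] ∧ ∀ j : Fin k, ∃ lab : Fin m × ℕ, ([j], lab) ∈ S))) ∧ (∃ j : Fin k, ∀ lab : Fin m × ℕ, ([j], lab) ∉ S) ∧
      ∃ y : Fin m, (([] : List (Fin k)), (y, Λ - 1)) ∈ S), (∏ e ∈ S, ((1 / 2 : ℝ) ^ k * (if e.1 = [] then (1 : ℝ) else 1 / (n : ℝ)))) with hAsum
  set Usum : ℝ := ∑ S ∈ (TS d).filter (fun S => ((∀ e ∈ S, ∀ (j : Fin k) (y : Fin m) (s : ℕ), (j :: e.1, (y, s)) ∈ S →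
        s < e.2.2 ∧ ∃ j' : Fin k, ∀ lab : Fin m × ℕ, (j' :: j :: e.1, lab) ∉ S) ∧
      (∀ e ∈ S, 1 ≤ e.2.2 → (∃ (j : Fin k) (y : Fin m), (j :: e.1, (y, e.2.2 - 1)) ∈ S) ∨
        (e.1 = [] ∧ ∀ j : Fin k, ∃ lab : Fin m × ℕ, ([j], lab) ∈ S))) ∧ (∃ j : Fin k, ∀ lab : Fin m × ℕ, ([j], lab) ∉ S) ∧
      ∃ (y : Fin m) (s' : ℕ), (([] : List (Fin k)), (y, s')) ∈ S ∧ s' < Λ), (∏ e ∈ S, ((1 / 2 : ℝ) ^ k * (if e.1 = [] then (1 : ℝ) else 1 / (n : ℝ)))) with hUsum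
  have hRle : Rsum ≤ (m : ℝ) * k * (1 / 2 : ℝ) ^ k * (Asum / n) * (1 + Usum / n) ^ (k - 1) :=
    sissR_weight_recent asm hasm TS L hTS0 hTSs d Λ
  have hFle : Fsum ≤ (m : ℝ) * (1 / 2 : ℝ) ^ k * (Usum / n) ^ k :=
    sissR_weight_full asm hasm TS L hTS0 hTSs d Λ
  have hA : Asum ≤ (m : ℝ) * (1 / 2 : ℝ) ^ k * (1 / 2 : ℝ) ^ (Λ - 1) := hdecay d (Λ - 1)
  have hU0 : 0 ≤ Usum := Finset.sum_nonneg fun S _ => sissR_wt_nonneg S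
  have hUle : Usum ≤ (m : ℝ) * (1 / 2 : ℝ) ^ k * 2 := by
    have hcov' := sissR_sum_cover_le ((TS d).filter (fun S => ((∀ e ∈ S, ∀ (j : Fin k) (y : Fin m) (s : ℕ), (j :: e.1, (y, s)) ∈ S →
        s < e.2.2 ∧ ∃ j' : Fin k, ∀ lab : Fin m × ℕ, (j' :: j :: e.1, lab) ∉ S) ∧
      (∀ e ∈ S, 1 ≤ e.2.2 → (∃ (j : Fin k) (y : Fin m), (j :: e.1, (y, e.2.2 - 1)) ∈ S) ∨
        (e.1 = [] ∧ ∀ j : Fin k, ∃ lab : Fin m × ℕ, ([j], lab) ∈ S))) ∧ (∃ j : Fin k, ∀ lab : Fin m × ℕ, ([j], lab) ∉ S) ∧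
        ∃ (y : Fin m) (s' : ℕ), (([] : List (Fin k)), (y, s')) ∈ S ∧ s' < Λ)) (Finset.range Λ)
      (fun s' => (TS d).filter (fun S => ((∀ e ∈ S, ∀ (j : Fin k) (y : Fin m) (s : ℕ), (j :: e.1, (y, s)) ∈ S →
        s < e.2.2 ∧ ∃ j' : Fin k, ∀ lab : Fin m × ℕ, (j' :: j :: e.1, lab) ∉ S) ∧
      (∀ e ∈ S, 1 ≤ e.2.2 → (∃ (j : Fin k) (y : Fin m), (j :: e.1, (y, e.2.2 - 1)) ∈ S) ∨
        (e.1 = [] ∧ ∀ j : Fin k, ∃ lab : Fin m × ℕ, ([j], lab) ∈ S))) ∧ (∃ j : Fin k, ∀ lab : Fin m × ℕ, ([j], lab) ∉ S) ∧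
        ∃ y : Fin m, (([] : List (Fin k)), (y, s')) ∈ S))
      (fun S => ∏ e ∈ S, ((1 / 2 : ℝ) ^ k * (if e.1 = [] then (1 : ℝ) else 1 / (n : ℝ)))) sissR_wt_nonneg (by
        intro S hS
        rw [Finset.mem_filter] at hS
        obtain ⟨hTS, hl, hno, y, s', hy, hs'⟩ := hS
        exact ⟨s', Finset.mem_range.2 hs', by rw [Finset.mem_filter]; exact ⟨hTS, hl, hno, y, hy⟩⟩)
    have hgeo : ∑ s' ∈ Finset.range Λ, (m : ℝ) * (1 / 2 : ℝ) ^ k * (1 / 2 : ℝ) ^ s'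
        ≤ (m : ℝ) * (1 / 2 : ℝ) ^ k * 2 := by
      rw [← Finset.mul_sum]
      refine mul_le_mul_of_nonneg_left ?_ (by positivity)
      have := geom_sum_Ico_le_of_lt_one (show (0 : ℝ) ≤ 1 / 2 by norm_num)
        (show (1 / 2 : ℝ) < 1 by norm_num) (m := 0) (n := Λ)
      rw [Finset.range_eq_Ico]
      refine this.trans ?_
      norm_num
    exact (hcov'.trans (Finset.sum_le_sum fun s' _ => hdecay d s')).trans hgeo
  have ha : Asum / n ≤ (m : ℝ) * (1 / 2 : ℝ) ^ k / n * (1 / 2 : ℝ) ^ (Λ - 1) := by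
    rw [div_mul_eq_mul_div]
    exact div_le_div_of_nonneg_right hA hn0.le
  have hu2 : Usum / n ≤ 2 * ((m : ℝ) * (1 / 2 : ℝ) ^ k / n) := by
    calc Usum / n ≤ (m : ℝ) * (1 / 2 : ℝ) ^ k * 2 / n := div_le_div_of_nonneg_right hUle hn0.le
      _ = 2 * ((m : ℝ) * (1 / 2 : ℝ) ^ k / n) := by ring
  have hu : Usum / n ≤ 1 / (2 * (k : ℝ)) := by
    calc Usum / n ≤ 2 * ((m : ℝ) * (1 / 2 : ℝ) ^ k / n) := hu2
      _ ≤ 2 * (1 / (4 * k)) := by linarith [hdens]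
      _ = 1 / (2 * k) := by field_simp; ring
  have hcore := sissR_num_core k Λ hk hΛ (m : ℝ) ((m : ℝ) * (1 / 2 : ℝ) ^ k / n) (Asum / n) (Usum / n)
    hm0 (by positivity) hkD ha (div_nonneg hU0 hn0.le) hu
  have hfull : (Usum / n) ^ k ≤ (2 * ((m : ℝ) * (1 / 2 : ℝ) ^ k / n)) ^ k :=
    pow_le_pow_left₀ (div_nonneg hU0 hn0.le) hu2 k
  have hP : 0 ≤ (m : ℝ) * (1 / 2 : ℝ) ^ k := by positivity
  calc Rsum + Fsum ≤ (m : ℝ) * (1 / 2 : ℝ) ^ k * (1 / 2 : ℝ) ^ Λ +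
        (m : ℝ) * (1 / 2 : ℝ) ^ k * (2 * ((m : ℝ) * (1 / 2 : ℝ) ^ k / n)) ^ k :=
      add_le_add (hRle.trans hcore) (hFle.trans (mul_le_mul_of_nonneg_left hfull hP))
    _ = (m : ℝ) * (1 / 2 : ℝ) ^ k * ((1 / 2 : ℝ) ^ Λ + (2 * ((m : ℝ) * (1 / 2 : ℝ) ^ k / n)) ^ k) := by
        ring

end WeightBound

end Summit.PneNP.PneNP.Theorems
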